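import Literature.AlgebraicGeometry.ModuliOfAbelianVarieties.SiegelAdelicMarkingSamePoint
import Literature.AlgebraicGeometry.ModuliOfAbelianVarieties.SiegelAdelicMarkingStableLines
import HarnessLib

/-!
# The rational representation of a homomorphism of marked abelian varieties is UNIQUE — hence every reading is `ℂ`-linear
# ([Birkenhake–Lange 2004] §1.2 Prop. 1.2.1 (`ρ_r` injective); [Mumford 1970] §19 Thm. 3; [Milne 2005] Thm. 6.11)

Topic `AlgebraicGeometry/ModuliOfAbelianVarieties`; namespace `Literature.AlgebraicGeometry.ModuliOfAbelianVarieties(.SiegelAdelicMarking)`.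
THEOREMS ONLY (no definition, no named fact, no instance, no notation, no `sorry`; net Literature debt 0).  Cell `hodgecm-mathlib` (D-0151), FLOOR 0,
P6 «MOD programme» (crux hLiu418 = stmt-HodgeConjecture-24832, `--supports`, count-neutral); DEFAULT organ of LA6-p02 (g2) closing the census MISS (c4)
of DEAL L5-#9 (O-HF): the `ℂ`-linearity binder `hMJ : (M₁ b)_ℝ J₁ = J₁ (M₁ b)_ℝ` of ★ `SiegelAdelicMarking.exists_idealHomFamily` is DERIVABLE from the
reading `ι₁ b (u₁ v) = u₁ (M₁ b · v)` alone.  HC_CM is proved only modulo the printed citations until rung 0 closes.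

* §1 `matrix_eq_zero_of_forall_mulVec_mem_latticeOfGL` — a rational matrix `D` with `D·ℚ^{2g} ⊆ Λ_a` is `0` (bounded denominators of `Λ_a = ℚ^{2g} ∩ a ẑ^{2g}`,
  ★ `exists_nat_mul_entries_mem` ∕ `exists_int_cast_eq_natCast_mul_of_mem_latticeOfGL`, tested on `v = (2N D_{ij})⁻¹ e_j`); the rational twin of ★
  `adelicMatrix_eq_zero_of_forall_mulVec_adelicVec_mem`.
* §2 `SiegelAdelicMarking.eq_of_forall_r_mulVec_eq` — **two rational matrices with the same reading through a marking are equal**: `u(q v) = u(q′ v)` for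
  all `v` forces `q = q′` (`u = m.r` has kernel `Λ_a`, ★ `r_eq_one_iff_mem_latticeOfGL`).
* §3 `SiegelAdelicMarking.map_mul_eq_mul_map_of_forall_map_r_eq` — **every reading is `ℂ`-linear**: if `f(u v) = u′(q v)` for a homomorphism `f : A ⟶ A′` then
  `q_ℝ J = J′ q_ℝ` (★ `exists_ratRep_of_hom` gives SOME `ℂ`-linear reading, §2 identifies it with `q`); `…_intCast` the integer-matrix form (= the `hMJ`
  binder of ★ (O-HF) `exists_idealHomFamily`, now dischargeable from `hι₁`).

## References
* [BirkenhakeLange2004] C. Birkenhake, H. Lange, *Complex Abelian Varieties*, 2nd ed. (2004), §1.2 Prop. 1.2.1 (the representations `ρ_a`, `ρ_r` are injective).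
* [MumfordAV1970] D. Mumford, *Abelian Varieties* (1970), §19 Thm. 3 (p. 176).
* [Milne2005ShimuraVarieties] J. S. Milne, *Introduction to Shimura varieties* (2005), §6 Thm. 6.11 p. 74 and p. 75, §4 p. 48.
-/

set_option autoImplicit false

noncomputable section

open CategoryTheory AlgebraicGeometry Matrix
open Literature.AlgebraicGeometry.Motives (SchemeOver ComplexPoints AlgPoints specOver AbelianVariety)
open Literature.NumberTheory.Adeles (latticeOfGL exists_nat_mul_entries_mem exists_int_cast_eq_natCast_mul_of_mem_latticeOfGL)

namespace Literature.AlgebraicGeometry.ModuliOfAbelianVarieties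

variable {g : ℕ} {δ : Fin g → ℕ}

/-! ### §1 A rational matrix with values in a lattice vanishes -/

/-- **A rational matrix `D` with `D v ∈ Λ_a` for EVERY `v ∈ ℚ^{2g}` is zero**: `Λ_a` has bounded denominators (`N Λ_a ⊆ ℤ^{2g}` for a common denominator
`N` of `a`), while `D((2N D_{ij})⁻¹ e_j)` has `i`-th coordinate `(2N)⁻¹`. [cite: Milne2005ShimuraVarieties, §4 p. 48 and §6 p. 75] -/
theorem matrix_eq_zero_of_forall_mulVec_mem_latticeOfGL {a : GL (Fin g ⊕ Fin g) finAdeleQ} {D : Matrix (Fin g ⊕ Fin g) (Fin g ⊕ Fin g) ℚ}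
    (h : ∀ v : Fin g ⊕ Fin g → ℚ, D *ᵥ v ∈ latticeOfGL a) : D = 0 := by
  obtain ⟨N, hN, hNa, -⟩ := exists_nat_mul_entries_mem a
  ext i j
  rw [Matrix.zero_apply]
  by_contra hij
  set c : ℚ := 2 * N * D i j with hc
  have hc0 : c ≠ 0 := mul_ne_zero (mul_ne_zero two_ne_zero (Nat.cast_ne_zero.2 hN)) hij
  have hDv : (D *ᵥ (c⁻¹ • (Pi.single j 1 : Fin g ⊕ Fin g → ℚ))) i = D i j * c⁻¹ := by
    simp [Matrix.mulVec, dotProduct, Pi.single_apply]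
  obtain ⟨z, hz⟩ := exists_int_cast_eq_natCast_mul_of_mem_latticeOfGL hNa (h (c⁻¹ • Pi.single j 1)) i
  rw [hDv, hc] at hz
  have hz' : (z : ℚ) * 2 = 1 := by
    rw [hz]
    field_simp
  have hz2 : z * 2 = 1 := by exact_mod_cast hz'
  omega

/-! ### §2 Uniqueness of the rational representation -/

namespace SiegelAdelicMarking

variable {J J' : C0pm δ} {a a' : gspFinAdelic δ} {A A' : AbelianVariety ℂ}

/-- **Two rational matrices read identically through a marking are equal**: if `u(q v) = u(q′ v)` for all `v ∈ V` then `q = q′` — `u = m.r` is a homomorphism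
with kernel exactly `Λ_a` (★ `r_add`, `r_neg`, `r_eq_one_iff_mem_latticeOfGL`), so `(q − q′) V ⊆ Λ_a`, and §1.  (Injectivity of the rational representation,
[BirkenhakeLange2004] Prop. 1.2.1.) [cite: BirkenhakeLange2004, §1.2 Prop. 1.2.1] [cite: Milne2005ShimuraVarieties, §6 Thm. 6.11 p. 74 and p. 75] -/
theorem eq_of_forall_r_mulVec_eq (m : SiegelAdelicMarking J a A) {q q' : Matrix (Fin g ⊕ Fin g) (Fin g ⊕ Fin g) ℚ}
    (h : ∀ v : Fin g ⊕ Fin g → ℚ, m.r (q *ᵥ v) = m.r (q' *ᵥ v)) : q = q' := by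
  have hD : ∀ v : Fin g ⊕ Fin g → ℚ, (q - q') *ᵥ v ∈ latticeOfGL (a : GL (Fin g ⊕ Fin g) finAdeleQ) := fun v => by
    rw [← m.r_eq_one_iff_mem_latticeOfGL, Matrix.sub_mulVec, sub_eq_add_neg, m.r_add, m.r_neg, h v, mul_inv_cancel]
  exact sub_eq_zero.1 (matrix_eq_zero_of_forall_mulVec_mem_latticeOfGL hD)

/-! ### §3 Every reading is `ℂ`-linear -/

/-- **A homomorphism READING a rational matrix `q` on two markings has `q` `ℂ`-LINEAR: `q_ℝ J = J′ q_ℝ`** — ★ `exists_ratRep_of_hom` provides some `ℂ`-linear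
reading `q₀` of `f`, and §2 gives `q = q₀`.  ([BirkenhakeLange2004] Prop. 1.2.1: `ρ_r = ρ_a ⊕ ρ̄_a` commutes with the complex structures.)
[cite: BirkenhakeLange2004, §1.2 Prop. 1.2.1] [cite: MumfordAV1970, §19 Thm. 3 (p. 176)] [cite: Milne2005ShimuraVarieties, §6 Thm. 6.11 p. 74] -/
theorem map_mul_eq_mul_map_of_forall_map_r_eq (m : SiegelAdelicMarking J a A) (m' : SiegelAdelicMarking J' a' A') (f : A ⟶ A')
    (q : Matrix (Fin g ⊕ Fin g) (Fin g ⊕ Fin g) ℚ)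
    (hf : ∀ v : Fin g ⊕ Fin g → ℚ, AlgPoints.map f.hom.hom.hom (m.r v) = m'.r (q *ᵥ v)) :
    q.map (algebraMap ℚ ℝ) * (J : Matrix (Fin g ⊕ Fin g) (Fin g ⊕ Fin g) ℝ) =
      (J' : Matrix (Fin g ⊕ Fin g) (Fin g ⊕ Fin g) ℝ) * q.map (algebraMap ℚ ℝ) := by
  obtain ⟨q₀, hq₀, hJ⟩ := exists_ratRep_of_hom m m' f
  have hqq : q = q₀ := m'.eq_of_forall_r_mulVec_eq fun v => by rw [← hf v, hq₀ v]
  rw [hqq]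
  exact hJ

/-- **Integer-matrix form** (the `hMJ` binder of ★ `exists_idealHomFamily`, discharged from the reading `hι`): an endomorphism∕homomorphism reading an
INTEGER matrix `M` (`f(u v) = u′(M v)`) has `M_ℝ J = J′ M_ℝ`. [cite: BirkenhakeLange2004, §1.2 Prop. 1.2.1] [cite: MumfordAV1970, §19 Thm. 3 (p. 176)] -/
theorem map_intCast_mul_eq_mul_map_intCast_of_forall_map_r_eq (m : SiegelAdelicMarking J a A) (m' : SiegelAdelicMarking J' a' A')
    (f : A ⟶ A') (M : Matrix (Fin g ⊕ Fin g) (Fin g ⊕ Fin g) ℤ)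
    (hf : ∀ v : Fin g ⊕ Fin g → ℚ, AlgPoints.map f.hom.hom.hom (m.r v) = m'.r (M.map (Int.cast : ℤ → ℚ) *ᵥ v)) :
    M.map (Int.cast : ℤ → ℝ) * (J : Matrix (Fin g ⊕ Fin g) (Fin g ⊕ Fin g) ℝ) =
      (J' : Matrix (Fin g ⊕ Fin g) (Fin g ⊕ Fin g) ℝ) * M.map (Int.cast : ℤ → ℝ) := by
  have h := map_mul_eq_mul_map_of_forall_map_r_eq m m' f (M.map (Int.cast : ℤ → ℚ)) hf
  have hcast : (M.map (Int.cast : ℤ → ℚ)).map (algebraMap ℚ ℝ) = M.map (Int.cast : ℤ → ℝ) := by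
    ext i j
    simp
  rwa [hcast] at h

end SiegelAdelicMarking

end Literature.AlgebraicGeometry.ModuliOfAbelianVarieties

end
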